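import Mathlib.Analysis.Complex.RealDeriv
import Mathlib.Analysis.Calculus.Deriv.Mul
import Mathlib.Analysis.Calculus.Deriv.Comp
import Mathlib.Analysis.Calculus.Deriv.Add
import Mathlib.LinearAlgebra.Matrix.Trace
import Mathlib.LinearAlgebra.Matrix.ConjTranspose
import Mathlib.Data.Matrix.Basis
import Mathlib.Analysis.CStarAlgebra.Matrix
import HarnessLib

/-!
# K0⁷ STUB 1 (`stub_prop8StepCoP13`), sub-target S4b «the (δ∕δA′)V pieces at objects», brick 13:
# **REALITY OF THE CURRENT FROM THE (63)-CERTIFICATE** — if `V` is real on Lie-algebra-valued (skew-Hermitian) configurations near `A′` and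
# `DV(A′) = ⟨W(A′), ·⟩` for a trace pairing, then `W(A′)` is skew-Hermitian-valued: the `𝔤`-valuedness of Sect. F's `W = (δ∕δA′)V` that the reality clause of
# Prop. 6 for (158) consumes (UST `FlatSmallSolution158Levels.existsUnique_smallSolution158W_valued` ∕ k0-s1-w1's `_recordDom`: «solutions are `S`-valued for every
# closed `S ∋ 0` preserved by `X ↦ −G̃(W(X + HB))`»)

Cell `pub-ymgap`, width seat `pub-ymgap-k0-s1-w2` g2 (director-ym №197 ∕ HUMAN RULING D-0149; plan g77–g81 W-SEAT-START-LIST §k0-s1, w2 ↦ S4b).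
`--kind proof --supports stmt-QuantumFields-20541 --as helper`; count-neutral.  [15] = [Balaban1985Variational].

WHY.  The capstone `K0Stub1SectFWSlotOneLevel.exists_sectF_W_oneLevel ∕ _levOf` (p596653) delivers `W` on COMPLEX fields `PBond P 0 → M_N(ℂ)` (Prop. 4: «A′ with
values in the complexified Lie algebra 𝔤ᶜ») with the certificate `DV(A′) = BE(W A′, ·)`, `BE` the pairing (27) `η^d Σ_b τ(Y_b δ_b)`.  Prop. 6's reality clause needs
`W` to map 𝔤-valued (skew-Hermitian) configurations to 𝔤-valued ones.  In print this is implicit (V is a real functional of a real field); in the kernel it is the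
following two facts, typed here once, generically: (i) if `V` is real along the real line `A′ + tδ` near `t = 0` and `ℂ`-differentiable at `A′`, then `DV(A′)δ` is
real; (ii) a family `W` with `Σ_b tr(W_b δ_b)` real for every skew-Hermitian `δ` is skew-Hermitian (test against `E_{jk} − E_{kj}` and `i(E_{jk} + E_{kj})` at one bond).

WHAT IS PROVED (sorry-free; no definition; axioms standard).
* §1 ★ `im_eq_zero_of_hasFDerivAt_of_real_along` — `E` a complex normed space, `V : E → ℂ` with `HasFDerivAt V L A`, and `(V (A + t•δ)).im = 0` for real `t` near `0`
  ⇒ `(L δ).im = 0`.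
* §2 `sum_trace_mul_single_sub`, `sum_trace_mul_single_add` (the two test pairings at one bond), `matrixSingle_neg`, `skew_test_sub`, `skew_test_add` (the tests are
  skew-Hermitian), ★ `conjTranspose_eq_neg_of_trace_pair_real` — `W : ι → Matrix n n ℂ` with
  `(Σ_i tr(W_i δ_i)).im = 0` for every skew-Hermitian-valued `δ` ⇒ every `W_i` is skew-Hermitian.
* §3 ★★ `skew_of_certificate` — THE COMBINATION: for a pairing `BE Y δ = c·Σ_i tr(Y_i δ_i)` with `c` real non-zero (print: `c = η^d`, or `η^d∕N` for the normalised
  trace), a map `W` with the certificate `HasFDerivAt V (BE (W A)) A`, and `V` real along every skew line through `A` near `0`: `W A` is skew-Hermitian-valued —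
  the hypothesis «`W` preserves `𝔤`-valued fields» of the reality clause, from the certificate (i) of the capstone plus the reality of `V`.
HONEST SCOPE.  Generic calculus ∕ matrix algebra; the reality of Sect. F's `V` on skew configurations (real kernels `Q, M, H`; `D` real-structure-preserving — S2's
chart; `V₀` real on unitary configurations — pv27) is the consumer's letter, displayed; nothing of [15]'s analysis asserted; `stub_prop8StepCoP13` ∕ K0⁷ NOT closed;
N07 NOT discharged; counts unmoved (28∕28 · 5∕27); one finite 𝕋⁴ programme at fixed ε — R4 closes the conditional finite-𝕋⁴ rung `BalabanLadder.UV` only, never the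
summit; the YM mass gap (Clay) is NOT proved by any of this; nothing continuum ∕ ℝ⁴ ∕ OS.  No `sorry`, no `def`, no `instance`, no `notation`.

References: [15] Prop. 4 p.292, (27) p.282, (63) p.287, Prop. 6 p.295, (158) p.302.
(v1.1 APPEND, same seat: §4 the HERMITIAN twin for print's own convention `U = exp(iηA)`, `A` Hermitian — `herm_test_add/_sub`, `sum_trace_mul_single_add_one`,
`sum_trace_mul_single_sub_I`, ★ `conjTranspose_eq_of_trace_pair_real_herm`, ★★ `herm_of_certificate`; §1–§3 byte-identical.)
-/

set_option autoImplicit false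

noncomputable section

namespace Summit.QuantumFields.YangMills.Theorems.K0Stub1RealityFromCertificate

open scoped BigOperators Matrix
open Filter Topology

/-! ## §1  A function real along a real line has a real derivative along it -/

section RealAlong

variable {E : Type*} [NormedAddCommGroup E] [NormedSpace ℂ E]

/-- ★ **REAL ALONG A LINE ⇒ REAL DERIVATIVE ALONG IT**: if `V : E → ℂ` has Fréchet derivative `L` at `A` and `V(A + tδ)` is real for real `t` near `0`, then `L δ`
is real — the restriction to `t ∈ ℝ` of `t ↦ V(A + tδ)` has derivative `L δ` at `0` (chain rule + `HasDerivAt.comp_ofReal`) and its imaginary part is locally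
constant `0`. [cite: Balaban1985Variational, (63) p.287, Prop. 4 p.292] -/
theorem im_eq_zero_of_hasFDerivAt_of_real_along (V : E → ℂ) {A δ : E} {L : E →L[ℂ] ℂ} (hV : HasFDerivAt V L A)
    (hreal : ∀ᶠ t : ℝ in 𝓝 0, (V (A + (t : ℂ) • δ)).im = 0) : (L δ).im = 0 := by
  -- the complex line derivative
  have e0 : A + ((0 : ℝ) : ℂ) • δ = A := by rw [Complex.ofReal_zero, zero_smul, add_zero]
  have hV' : HasFDerivAt V L (A + ((0 : ℝ) : ℂ) • δ) := by rw [e0]; exact hV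
  have hl : HasDerivAt (fun t : ℂ => A + t • δ) δ ((0 : ℝ) : ℂ) := by
    simpa using ((hasDerivAt_id ((0 : ℝ) : ℂ)).smul_const δ).const_add A
  have hline : HasDerivAt (fun t : ℂ => V (A + t • δ)) (L δ) ((0 : ℝ) : ℂ) := hV'.comp_hasDerivAt _ hl
  -- restrict to real `t` and take the imaginary part
  have hrealLine : HasDerivAt (fun t : ℝ => V (A + (t : ℂ) • δ)) (L δ) 0 := hline.comp_ofReal
  have him : HasDerivAt (fun t : ℝ => (V (A + (t : ℂ) • δ)).im) (L δ).im 0 := by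
    have := (Complex.imCLM.hasFDerivAt.comp_hasDerivAt (0 : ℝ) hrealLine)
    simpa [Function.comp_def] using this
  -- the imaginary part is eventually `0`, hence has derivative `0`
  have hzero : HasDerivAt (fun t : ℝ => (V (A + (t : ℂ) • δ)).im) 0 0 :=
    (hasDerivAt_const (0 : ℝ) (0 : ℝ)).congr_of_eventuallyEq (hreal.mono fun t ht => ht)
  exact him.unique hzero

end RealAlong

/-! ## §2  A family paired real against every skew-Hermitian family is skew-Hermitian -/

section Skew

variable {ι n : Type*} [Fintype ι] [DecidableEq ι] [Fintype n] [DecidableEq n]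

/-- The test pairing against `E_{jk} − E_{kj}` at one bond: `Σ_i tr(W_i · δ_i) = W_{i₀}(k,j) − W_{i₀}(j,k)`. [folklore] -/
theorem sum_trace_mul_single_sub (W : ι → Matrix n n ℂ) (i₀ : ι) (j k : n) :
    ∑ i, Matrix.trace (W i * (Pi.single i₀ (Matrix.single j k (1 : ℂ) - Matrix.single k j (1 : ℂ)) : ι → Matrix n n ℂ) i) = W i₀ k j - W i₀ j k := by
  rw [Finset.sum_eq_single i₀ (fun i _ hi => by simp [Pi.single_eq_of_ne hi]) (fun h => (h (Finset.mem_univ _)).elim),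
    Pi.single_eq_same, mul_sub, Matrix.trace_sub, Matrix.trace_mul_single, Matrix.trace_mul_single]
  simp

/-- The test pairing against `i(E_{jk} + E_{kj})` at one bond: `Σ_i tr(W_i · δ_i) = i·(W_{i₀}(k,j) + W_{i₀}(j,k))`. [folklore] -/
theorem sum_trace_mul_single_add (W : ι → Matrix n n ℂ) (i₀ : ι) (j k : n) :
    ∑ i, Matrix.trace (W i * (Pi.single i₀ (Matrix.single j k Complex.I + Matrix.single k j Complex.I) : ι → Matrix n n ℂ) i)
      = Complex.I * (W i₀ k j + W i₀ j k) := by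
  rw [Finset.sum_eq_single i₀ (fun i _ hi => by simp [Pi.single_eq_of_ne hi]) (fun h => (h (Finset.mem_univ _)).elim),
    Pi.single_eq_same, mul_add, Matrix.trace_add, Matrix.trace_mul_single, Matrix.trace_mul_single]
  simp [mul_comm, mul_add]

omit [Fintype ι] [DecidableEq ι] [Fintype n] in
/-- `single j k (−a) = −single j k a`. [folklore] -/
theorem matrixSingle_neg (j k : n) (a : ℂ) : Matrix.single j k (-a) = -Matrix.single j k a := by
  ext j' k'
  by_cases h : j = j' ∧ k = k'
  · simp [Matrix.single, h]
  · simp [Matrix.single, h]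

omit [Fintype ι] [Fintype n] in
/-- The first test family is skew-Hermitian-valued. [folklore] -/
theorem skew_test_sub (i₀ : ι) (j k : n) (i : ι) :
    ((Pi.single i₀ (Matrix.single j k (1 : ℂ) - Matrix.single k j (1 : ℂ)) : ι → Matrix n n ℂ) i)ᴴ
      = -((Pi.single i₀ (Matrix.single j k (1 : ℂ) - Matrix.single k j (1 : ℂ)) : ι → Matrix n n ℂ) i) := by
  by_cases hi : i = i₀
  · subst hi
    rw [Pi.single_eq_same, Matrix.conjTranspose_sub, Matrix.conjTranspose_single, Matrix.conjTranspose_single, star_one, neg_sub]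
  · rw [Pi.single_eq_of_ne hi, Matrix.conjTranspose_zero, neg_zero]

omit [Fintype ι] [Fintype n] in
/-- The second test family is skew-Hermitian-valued. [folklore] -/
theorem skew_test_add (i₀ : ι) (j k : n) (i : ι) :
    ((Pi.single i₀ (Matrix.single j k Complex.I + Matrix.single k j Complex.I) : ι → Matrix n n ℂ) i)ᴴ
      = -((Pi.single i₀ (Matrix.single j k Complex.I + Matrix.single k j Complex.I) : ι → Matrix n n ℂ) i) := by
  by_cases hi : i = i₀
  · subst hi
    rw [Pi.single_eq_same, Matrix.conjTranspose_add, Matrix.conjTranspose_single, Matrix.conjTranspose_single, Complex.star_def,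
      Complex.conj_I, matrixSingle_neg, matrixSingle_neg, neg_add, add_comm]
  · rw [Pi.single_eq_of_ne hi, Matrix.conjTranspose_zero, neg_zero]

/-- ★ **PAIRED REAL AGAINST EVERY SKEW-HERMITIAN FAMILY ⇒ SKEW-HERMITIAN**: if `(Σ_i tr(W_i δ_i)).im = 0` for every skew-Hermitian-valued `δ`, then every `W_i` is
skew-Hermitian (entries: `Im W(k,j) = Im W(j,k)` from the test `E_{jk} − E_{kj}`, `Re W(k,j) = −Re W(j,k)` from `i(E_{jk} + E_{kj})`). [cite: Balaban1985Variational, (27) p.282, Prop. 4 p.292] -/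
theorem conjTranspose_eq_neg_of_trace_pair_real (W : ι → Matrix n n ℂ)
    (h : ∀ δ : ι → Matrix n n ℂ, (∀ i, (δ i)ᴴ = -(δ i)) → (∑ i, Matrix.trace (W i * δ i)).im = 0) (i₀ : ι) :
    (W i₀)ᴴ = -(W i₀) := by
  ext j k
  rw [Matrix.conjTranspose_apply, Matrix.neg_apply, Complex.star_def]
  have h1 := h (Pi.single i₀ (Matrix.single j k (1 : ℂ) - Matrix.single k j (1 : ℂ))) (skew_test_sub i₀ j k)
  have h2 := h (Pi.single i₀ (Matrix.single j k Complex.I + Matrix.single k j Complex.I)) (skew_test_add i₀ j k)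
  rw [sum_trace_mul_single_sub] at h1
  rw [sum_trace_mul_single_add] at h2
  rw [Complex.sub_im, sub_eq_zero] at h1
  rw [Complex.mul_im, Complex.I_re, Complex.I_im, zero_mul, one_mul, zero_add, Complex.add_re] at h2
  apply Complex.ext
  · rw [Complex.conj_re, Complex.neg_re]; linarith
  · rw [Complex.conj_im, Complex.neg_im, h1]

end Skew

/-! ## §3  ★★ Reality of the current from the certificate -/

section Combination

open scoped Matrix.Norms.L2Operator

variable {ι n : Type*} [Fintype ι] [DecidableEq ι] [Fintype n] [DecidableEq n]

/-- ★★ **`W(A)` IS `𝔤`-VALUED FROM THE (63)-CERTIFICATE AND THE REALITY OF `V`**: let `BE Y δ = c·Σ_i tr(Y_i δ_i)` with `c` real and non-zero (print's (27): `c = η^d`,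
or `η^d∕N` with the normalised trace), `V` with `HasFDerivAt V (BE (W A)) A` (the capstone's certificate (i)) and `V(A + tδ)` real for real `t` near `0` along every
skew-Hermitian direction `δ` (the reality of Sect. F's `V` on 𝔤-valued configurations — the consumer's letter): then `W A` is skew-Hermitian-valued — the
«`W` preserves `𝔤`-valued fields» input of Prop. 6's reality clause. [cite: Balaban1985Variational, Prop. 4 p.292, (63) p.287, Prop. 6 p.295, (158) p.302] -/
theorem skew_of_certificate (V : (ι → Matrix n n ℂ) → ℂ) (W : (ι → Matrix n n ℂ) → (ι → Matrix n n ℂ))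
    (BE : (ι → Matrix n n ℂ) →L[ℂ] (ι → Matrix n n ℂ) →L[ℂ] ℂ) {c : ℝ} (hc : c ≠ 0)
    (hBE : ∀ Y δ : ι → Matrix n n ℂ, BE Y δ = (c : ℂ) * ∑ i, Matrix.trace (Y i * δ i))
    {A : ι → Matrix n n ℂ} (hcert : HasFDerivAt V (BE (W A)) A)
    (hreal : ∀ δ : ι → Matrix n n ℂ, (∀ i, (δ i)ᴴ = -(δ i)) → ∀ᶠ t : ℝ in 𝓝 0, (V (A + (t : ℂ) • δ)).im = 0) (i₀ : ι) :
    (W A i₀)ᴴ = -(W A i₀) := by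
  refine conjTranspose_eq_neg_of_trace_pair_real (W A) (fun δ hδ => ?_) i₀
  have h := im_eq_zero_of_hasFDerivAt_of_real_along V hcert (hreal δ hδ)
  rw [hBE, Complex.mul_im, Complex.ofReal_re, Complex.ofReal_im, zero_mul, add_zero] at h
  exact (mul_eq_zero.mp h).resolve_left hc

end Combination


/-! ## §4  (v1.1 append) The HERMITIAN twin — print's own convention `U = exp(iηA)`, `A` Hermitian (pv27's `prodCfg`; g0's current) -/

section Hermitian

variable {ι n : Type*} [Fintype ι] [DecidableEq ι] [Fintype n] [DecidableEq n]

omit [Fintype ι] [Fintype n] in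
/-- The Hermitian test `E_{jk} + E_{kj}` at one bond is Hermitian-valued. [folklore] -/
theorem herm_test_add (i₀ : ι) (j k : n) (i : ι) :
    ((Pi.single i₀ (Matrix.single j k (1 : ℂ) + Matrix.single k j (1 : ℂ)) : ι → Matrix n n ℂ) i)ᴴ
      = (Pi.single i₀ (Matrix.single j k (1 : ℂ) + Matrix.single k j (1 : ℂ)) : ι → Matrix n n ℂ) i := by
  by_cases hi : i = i₀
  · subst hi
    rw [Pi.single_eq_same, Matrix.conjTranspose_add, Matrix.conjTranspose_single, Matrix.conjTranspose_single, star_one, add_comm]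
  · rw [Pi.single_eq_of_ne hi, Matrix.conjTranspose_zero]

omit [Fintype ι] [Fintype n] in
/-- The Hermitian test `i(E_{jk} − E_{kj})` at one bond is Hermitian-valued. [folklore] -/
theorem herm_test_sub (i₀ : ι) (j k : n) (i : ι) :
    ((Pi.single i₀ (Matrix.single j k Complex.I - Matrix.single k j Complex.I) : ι → Matrix n n ℂ) i)ᴴ
      = (Pi.single i₀ (Matrix.single j k Complex.I - Matrix.single k j Complex.I) : ι → Matrix n n ℂ) i := by
  by_cases hi : i = i₀
  · subst hi
    rw [Pi.single_eq_same, Matrix.conjTranspose_sub, Matrix.conjTranspose_single, Matrix.conjTranspose_single, Complex.star_def,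
      Complex.conj_I, matrixSingle_neg, matrixSingle_neg, sub_neg_eq_add, neg_add_eq_sub]
  · rw [Pi.single_eq_of_ne hi, Matrix.conjTranspose_zero]

/-- The Hermitian test pairings at one bond: `Σ_i tr(W_i(E_{jk} + E_{kj})) = W(k,j) + W(j,k)` … [folklore] -/
theorem sum_trace_mul_single_add_one (W : ι → Matrix n n ℂ) (i₀ : ι) (j k : n) :
    ∑ i, Matrix.trace (W i * (Pi.single i₀ (Matrix.single j k (1 : ℂ) + Matrix.single k j (1 : ℂ)) : ι → Matrix n n ℂ) i) = W i₀ k j + W i₀ j k := by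
  rw [Finset.sum_eq_single i₀ (fun i _ hi => by simp [Pi.single_eq_of_ne hi]) (fun h => (h (Finset.mem_univ _)).elim),
    Pi.single_eq_same, mul_add, Matrix.trace_add, Matrix.trace_mul_single, Matrix.trace_mul_single]
  simp

/-- … and `Σ_i tr(W_i · i(E_{jk} − E_{kj})) = i(W(k,j) − W(j,k))`. [folklore] -/
theorem sum_trace_mul_single_sub_I (W : ι → Matrix n n ℂ) (i₀ : ι) (j k : n) :
    ∑ i, Matrix.trace (W i * (Pi.single i₀ (Matrix.single j k Complex.I - Matrix.single k j Complex.I) : ι → Matrix n n ℂ) i)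
      = Complex.I * (W i₀ k j - W i₀ j k) := by
  rw [Finset.sum_eq_single i₀ (fun i _ hi => by simp [Pi.single_eq_of_ne hi]) (fun h => (h (Finset.mem_univ _)).elim),
    Pi.single_eq_same, mul_sub, Matrix.trace_sub, Matrix.trace_mul_single, Matrix.trace_mul_single]
  simp [mul_comm, mul_sub]

/-- ★ **PAIRED REAL AGAINST EVERY HERMITIAN FAMILY ⇒ HERMITIAN** (print's convention `U = e^{iηA}`, `A` Hermitian): if `(Σ_i tr(W_i δ_i)).im = 0` for every
Hermitian-valued `δ`, every `W_i` is Hermitian. [cite: Balaban1985Variational, (27) p.282, Prop. 4 p.292] -/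
theorem conjTranspose_eq_of_trace_pair_real_herm (W : ι → Matrix n n ℂ)
    (h : ∀ δ : ι → Matrix n n ℂ, (∀ i, (δ i)ᴴ = δ i) → (∑ i, Matrix.trace (W i * δ i)).im = 0) (i₀ : ι) :
    (W i₀)ᴴ = W i₀ := by
  ext j k
  rw [Matrix.conjTranspose_apply, Complex.star_def]
  have h1 := h (Pi.single i₀ (Matrix.single j k (1 : ℂ) + Matrix.single k j (1 : ℂ))) (herm_test_add i₀ j k)
  have h2 := h (Pi.single i₀ (Matrix.single j k Complex.I - Matrix.single k j Complex.I)) (herm_test_sub i₀ j k)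
  rw [sum_trace_mul_single_add_one] at h1
  rw [sum_trace_mul_single_sub_I] at h2
  rw [Complex.add_im] at h1
  rw [Complex.mul_im, Complex.I_re, Complex.I_im, zero_mul, one_mul, zero_add, Complex.sub_re, sub_eq_zero] at h2
  apply Complex.ext
  · rw [Complex.conj_re, h2]
  · rw [Complex.conj_im]; linarith

open scoped Matrix.Norms.L2Operator in
/-- ★★ **HERMITIAN TWIN OF `skew_of_certificate`** — for the convention `U = exp(iηA)` with `A` HERMITIAN (pv27's `prodCfg`, g0's V₀-current `exists_W_V0_flat`): pairing
`BE Y δ = c·Σ tr(Y_i δ_i)` (`c` real ≠ 0), certificate `HasFDerivAt V (BE (W A)) A`, and `V(A + tδ)` real for real `t` near `0` along every HERMITIAN `δ` ⇒ `W A` is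
Hermitian-valued. [cite: Balaban1985Variational, Prop. 4 p.292, (63) p.287, Prop. 6 p.295, (158) p.302] -/
theorem herm_of_certificate (V : (ι → Matrix n n ℂ) → ℂ) (W : (ι → Matrix n n ℂ) → (ι → Matrix n n ℂ))
    (BE : (ι → Matrix n n ℂ) →L[ℂ] (ι → Matrix n n ℂ) →L[ℂ] ℂ) {c : ℝ} (hc : c ≠ 0)
    (hBE : ∀ Y δ : ι → Matrix n n ℂ, BE Y δ = (c : ℂ) * ∑ i, Matrix.trace (Y i * δ i))
    {A : ι → Matrix n n ℂ} (hcert : HasFDerivAt V (BE (W A)) A)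
    (hreal : ∀ δ : ι → Matrix n n ℂ, (∀ i, (δ i)ᴴ = δ i) → ∀ᶠ t : ℝ in 𝓝 0, (V (A + (t : ℂ) • δ)).im = 0) (i₀ : ι) :
    (W A i₀)ᴴ = W A i₀ := by
  refine conjTranspose_eq_of_trace_pair_real_herm (W A) (fun δ hδ => ?_) i₀
  have h := im_eq_zero_of_hasFDerivAt_of_real_along V hcert (hreal δ hδ)
  rw [hBE, Complex.mul_im, Complex.ofReal_re, Complex.ofReal_im, zero_mul, add_zero] at h
  exact (mul_eq_zero.mp h).resolve_left hc

end Hermitian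

end Summit.QuantumFields.YangMills.Theorems.K0Stub1RealityFromCertificate

end
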